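import Mathlib
import Summits.ValiantsHypothesis.ValiantsHypothesis.Theses.BinomialElusive
import Summits.ValiantsHypothesis.ValiantsHypothesis.Theorems.BinomialElusiveNumericToPuiseux
import Summits.ValiantsHypothesis.ValiantsHypothesis.Theorems.BinomialElusiveNoShortRelations

/-!
# Birth skeleton (BC3) for crux `BinomialElusive.BinomialCandidate`
# (stmt-ValiantsHypothesis-7392, route-ValiantsHypothesis-BinomialElusive; skeleton-register, gen 1)

Crux decl `Summit.ValiantsHypothesis.ValiantsHypothesis.Theses.BinomialElusive.BinomialCandidate`
(the route thesis X, rank 4): for all large `m`, no quadratic polynomial map `Γ : ℂ^{m-1} → ℂ^m`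
has image containing the binomial curve `x ↦ (x^{E(2i+1)} + x^{E(2i+2)})_{i<m}`,
`E(j) = E_m(j) = Σ_{k ≤ h} (j (2m+2)^{h+1})^k`, `h = ⌊log₂ m⌋²`.

## The line: the route's own instantiation glue, with the peeling step cut at GMOW's seam

The route header (TWO-LAYER PLAN) foresees `BinomialCandidate ⇐ PeelingLemma → NumericToPuiseux →
NoShortRelations → BinomialCandidate (instantiation glue, k = 3)`; the two outer pieces are PROVED
support items (`numericToPuiseux_proof`, stmt-7396; `noShortRelations_proof`, stmt-7395), so the only
open content of X along this line is the PEELING step at the place over `x = 0`: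

> every formal Laurent solution `p ∈ ℂ((t))^{m-1}` of `Γ(p) = (t^{N a_i} + t^{N b_i})_i`, `Γ` quadratic,
> forces a nonzero integer relation among the `2m` exponents of length `≤ ⌊log₂ m⌋²`

(= the sibling crux `PeelingLemma`, stmt-7391, stated for GENERAL exponent data `a, b`, where the
short-relation conclusion is essential: degenerate data have solutions and relations of length `≤ 2`).
One stub `PeelingLemma` would be a one-leaf skeleton, so the peeling step is cut along the seam the
literature itself draws — Garg–Makam–Oliveira–Wigderson 2019 (arXiv:1904.04299) §9: Lemma 9.3 /
Remark 9.4 (symbolic criterion with POWER SERIES after a shift) and Prop. 9.8 (the toy monomial case is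
done only for substitutions with exponents in `ℚ_{≥0}`; "extending this result even to 'monomials'
with negative exponents seems like a challenging problem"):

* `stub_integralPeeling` (OPEN): peeling for INTEGRAL solutions, `p ∈ ℂ[[t]]^{m-1}`
  (`∀ j, 0 ≤ (p j).order`): the branch of the dominating curve over `x = 0` stays finite, `y₀ = p(0)`
  is an honest point of `ℂ^{m-1}` with `Γ(y₀) = f(0)`, and peeling is a jet computation at `y₀`
  (linear part of rank `≤ m-1 < m`, then quadrics on leading coefficients, valuation by valuation).
* `stub_polarPeeling` (OPEN, hardest): peeling for POLAR solutions (`∃ j, (p j).order < 0`): the curve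
  is swallowed only asymptotically, from points of `ℂ^{m-1}` escaping to infinity as `x → 0`; leading
  terms of `Γ_i(p)` MUST cancel in every coordinate using a polar variable quadratically (the target
  has nonnegative order), which is exactly the cancellation regime the route's why-it-might-fail names
  (unit cancellations living on one long relation).

Neither stub is comparable to the crux or to the summit by a cheap implication (BC3 probes
`stub → BinomialCandidate`, `stub → ValiantsHypothesis` by `first | exact? | simpa | aesop` FAIL for
both — registrar's NOTES.md), and neither implies the other (poles cannot be created or cleared inside a
fixed quadratic `Γ`).  Together they give `PeelingLemma` (`peelingLemma_of_stubs`, by cases on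
`∀ j, 0 ≤ (p j).order`), and the COMPOSITION `BinomialCandidate_of` is the route's instantiation glue,
kernel-checked and sorry-free (`binomialCandidate_of_peelingLemma : PeelingLemma → BinomialCandidate`):
containment ⟹ (`numericToPuiseux_proof` with `a_i = E(2i+1)`, `b_i = E(2i+2)`, `s = m-1`) a Laurent
solution ⟹ (peeling) a nonzero `(u, v)` with `Σ(|u_i|+|v_i|) ≤ ⌊log₂ m⌋²` and
`Σ(u_i E(2i+1) + v_i E(2i+2)) = 0` ⟹ (`noShortRelations_proof` with `h = ⌊log₂ m⌋²` and the interleaved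
vector `w(2i) = u_i`, `w(2i+1) = v_i` on `Fin (2m)`, re-indexed through
`Fin m × Fin 2 ≃ Fin (2m)`) `w = 0`, contradicting `(u, v) ≠ 0`.

## Shape (skeleton audit by-name rule, as in `Cruxes/ContractiveHardness/Lines/birth.lean`)
* `Stmt.stub_…` — the two stub statements as precise `Prop`s, named like the stubs;
* `stub_…` — the same statements as sorried theorems (the REGISTERED stubs; `sorry` occurs nowhere else);
* `BinomialCandidate_of` — the composition, real proof;
  `BinomialCandidate_proof : BinomialCandidate := BinomialCandidate_of stub_integralPeeling stub_polarPeeling`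
  ties the two copies.
Both stubs are DEF-FREE beyond Mathlib (`MvPolynomial`, `LaurentSeries`, `HahnSeries.single/order`,
`Nat.log`), so each can land as `Theorems/BinomialElusive<Stub>.lean` with
`--supports stmt-ValiantsHypothesis-7392` (and the pair closes `PeelingLemma`, stmt-7391, as well).

**Disproof used.** None exists: `Cruxes/BinomialCandidate/` had no workfiles (no `Disproof.lean`, no
`Negative/` lemma) at registration (2026-08-17).  `ledger negatives --problem ValiantsHypothesis`: the only
elusive-curve negative is `ElusiveCandidate` (stmt-0340, a MONOMIAL curve swallowed at `s = m-1`); a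
monomial target enters the stubs only as degenerate data `a_i = b_i` (target `2·t^{N a_i}`), where the
length-2 relation `a_i - b_i = 0` is the required conclusion — no stub is an instance it refutes.
Hardest stub: `stub_polarPeeling`.
-/

namespace Summit.ValiantsHypothesis.ValiantsHypothesis.Cruxes.BinomialCandidate.Birth

open scoped BigOperators
open Summit.ValiantsHypothesis.ValiantsHypothesis.Theses.BinomialElusive
open Summit.ValiantsHypothesis.ValiantsHypothesis.Theorems.BinomialElusiveRazTransfer (expo)

set_option linter.dupNamespace false

/-! ## The two stub statements -/

/-- STUB 1 — INTEGRAL PEELING (open).  For all large `m`: for all exponent data `a b : Fin m → ℕ`,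
every quadratic `Γ : ℂ^{m-1} → ℂ^m`, every `N ≥ 1` and every POWER-SERIES solution
`p ∈ ℂ[[t]]^{m-1}` (`∀ j, 0 ≤ (p j).order`) of `Γ(p) = (t^{N a_i} + t^{N b_i})_i`, the `2m` exponents
satisfy a nonzero integer relation `Σ_i (u_i a_i + v_i b_i) = 0` of length `Σ_i (|u_i| + |v_i|) ≤ ⌊log₂ m⌋²`.
Why plausibly true: `y₀ = p(0) ∈ ℂ^{m-1}` is an honest point with `Γ(y₀) = f(0)`; `Γ(y₀ + q) = L q + Q q`
with `rk L ≤ m - 1 < m`, so a nonzero `λ` kills `L` and `Σ λ_i (t^{N a_i} + t^{N b_i} - c_i) = λ·Q(q)` is a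
quadratic form in `q ∈ t ℂ[[t]]^{m-1}`; every cancellation of a lowest term is an additive coincidence
among target exponents and (sums of two) valuations of `q`, `2m` events against `m - 1` valuations
(GMOW 2019 Prop. 9.8 is the monomial-`Γ`, monomial-`p` instance; the route's ToricBinomialElusive the
monomial-`Γ` instance for binomial targets).  Why it might fail: a quadratic swallower whose power-series
branch realises a relation-free binomial family through iterated unit cancellations
`(x^a(1+x^c) - E) + E`.  Size: L (open). -/
def Stmt.stub_integralPeeling : Prop :=
  ∃ m₀ : ℕ, ∀ m ≥ m₀, ∀ (a b : Fin m → ℕ) (Γ : Fin m → MvPolynomial (Fin (m - 1)) ℂ) (N : ℕ)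
    (p : Fin (m - 1) → LaurentSeries ℂ), (∀ i, (Γ i).totalDegree ≤ 2) → 0 < N →
    (∀ j, 0 ≤ (p j).order) →
    (∀ i, MvPolynomial.aeval p (Γ i) =
      HahnSeries.single ((N * a i : ℕ) : ℤ) (1 : ℂ) + HahnSeries.single ((N * b i : ℕ) : ℤ) (1 : ℂ)) →
    ∃ u v : Fin m → ℤ, (u, v) ≠ 0 ∧ ∑ i, (|u i| + |v i|) ≤ ((Nat.log 2 m ^ 2 : ℕ) : ℤ) ∧
      ∑ i, (u i * (a i : ℤ) + v i * (b i : ℤ)) = 0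

/-- STUB 2 — POLAR PEELING (open; hardest stub).  The same conclusion for Laurent solutions with a
GENUINE POLE (`∃ j, (p j).order < 0`): the dominating curve covers the binomial curve near `x = 0` only
from points escaping to infinity.  Why plausibly true: the targets have nonnegative order, so in every
coordinate where a polar variable enters, the lowest-order products must cancel exactly — each
cancellation is an equation among leading coefficients supported on an additive coincidence of
valuations, and the bookkeeping of the route's PeelingLemma (two valuation events per coordinate against
`(m-1)·(jumps of p)` freedoms) is designed for this regime.  Why it might fail: GMOW 2019 flag exactly the
negative-exponent case as the hard one ("even to 'monomials' with negative exponents … challenging");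
Theorem N-type swallowers of monomial curves live on ONE long relation, and a polar binomial analogue
with relation length `≫ (log₂ m)²` would refute the stub (and, for the power-sum family, the crux).
Size: XL (open). -/
def Stmt.stub_polarPeeling : Prop :=
  ∃ m₀ : ℕ, ∀ m ≥ m₀, ∀ (a b : Fin m → ℕ) (Γ : Fin m → MvPolynomial (Fin (m - 1)) ℂ) (N : ℕ)
    (p : Fin (m - 1) → LaurentSeries ℂ), (∀ i, (Γ i).totalDegree ≤ 2) → 0 < N →
    (∃ j, (p j).order < 0) →
    (∀ i, MvPolynomial.aeval p (Γ i) =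
      HahnSeries.single ((N * a i : ℕ) : ℤ) (1 : ℂ) + HahnSeries.single ((N * b i : ℕ) : ℤ) (1 : ℂ)) →
    ∃ u v : Fin m → ℤ, (u, v) ≠ 0 ∧ ∑ i, (|u i| + |v i|) ≤ ((Nat.log 2 m ^ 2 : ℕ) : ℤ) ∧
      ∑ i, (u i * (a i : ℤ) + v i * (b i : ℤ)) = 0

/-! ## Registered stubs (the ONLY sorries of this file) -/

/-- Registered stub 1 = `Stmt.stub_integralPeeling` (peeling for power-series solutions). -/
theorem stub_integralPeeling :
    ∃ m₀ : ℕ, ∀ m ≥ m₀, ∀ (a b : Fin m → ℕ) (Γ : Fin m → MvPolynomial (Fin (m - 1)) ℂ) (N : ℕ)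
      (p : Fin (m - 1) → LaurentSeries ℂ), (∀ i, (Γ i).totalDegree ≤ 2) → 0 < N →
      (∀ j, 0 ≤ (p j).order) →
      (∀ i, MvPolynomial.aeval p (Γ i) =
        HahnSeries.single ((N * a i : ℕ) : ℤ) (1 : ℂ) + HahnSeries.single ((N * b i : ℕ) : ℤ) (1 : ℂ)) →
      ∃ u v : Fin m → ℤ, (u, v) ≠ 0 ∧ ∑ i, (|u i| + |v i|) ≤ ((Nat.log 2 m ^ 2 : ℕ) : ℤ) ∧
        ∑ i, (u i * (a i : ℤ) + v i * (b i : ℤ)) = 0 := by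
  sorry

/-- Registered stub 2 = `Stmt.stub_polarPeeling` (peeling for Laurent solutions with a pole). -/
theorem stub_polarPeeling :
    ∃ m₀ : ℕ, ∀ m ≥ m₀, ∀ (a b : Fin m → ℕ) (Γ : Fin m → MvPolynomial (Fin (m - 1)) ℂ) (N : ℕ)
      (p : Fin (m - 1) → LaurentSeries ℂ), (∀ i, (Γ i).totalDegree ≤ 2) → 0 < N →
      (∃ j, (p j).order < 0) →
      (∀ i, MvPolynomial.aeval p (Γ i) =
        HahnSeries.single ((N * a i : ℕ) : ℤ) (1 : ℂ) + HahnSeries.single ((N * b i : ℕ) : ℤ) (1 : ℂ)) →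
      ∃ u v : Fin m → ℤ, (u, v) ≠ 0 ∧ ∑ i, (|u i| + |v i|) ≤ ((Nat.log 2 m ^ 2 : ℕ) : ℤ) ∧
        ∑ i, (u i * (a i : ℤ) + v i * (b i : ℤ)) = 0 := by
  sorry

/-! ## The composition (kernel-checked, sorry-free) -/

/-- The two stubs give the sibling crux `PeelingLemma` (stmt-ValiantsHypothesis-7391): cases on
whether the Laurent solution is integral. -/
theorem peelingLemma_of_stubs (h₁ : Stmt.stub_integralPeeling) (h₂ : Stmt.stub_polarPeeling) :
    Summit.ValiantsHypothesis.ValiantsHypothesis.Theses.BinomialElusive.PeelingLemma := by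
  obtain ⟨m₁, hm₁⟩ := h₁
  obtain ⟨m₂, hm₂⟩ := h₂
  refine ⟨max m₁ m₂, fun m hm a b Γ N p hΓ hN hp => ?_⟩
  by_cases hint : ∀ j, 0 ≤ (p j).order
  · exact hm₁ m (le_of_max_le_left hm) a b Γ N p hΓ hN hint hp
  · push Not at hint
    exact hm₂ m (le_of_max_le_right hm) a b Γ N p hΓ hN hint hp

/-- The route's instantiation glue `PeelingLemma → BinomialCandidate`, with the two PROVED supports
discharged: `numericToPuiseux_proof` (stmt-7396) produces the Laurent solution at the place over `x = 0`
for `a_i = E(2i+1)`, `b_i = E(2i+2)`, `s = m - 1`; `PeelingLemma` gives a short nonzero relation;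
`noShortRelations_proof` (stmt-7395) with `h = ⌊log₂ m⌋²` kills the interleaved relation vector
`w(2i) = u_i`, `w(2i+1) = v_i` on `Fin (2m)`. -/
theorem binomialCandidate_of_peelingLemma
    (hP : Summit.ValiantsHypothesis.ValiantsHypothesis.Theses.BinomialElusive.PeelingLemma) :
    Summit.ValiantsHypothesis.ValiantsHypothesis.Theses.BinomialElusive.BinomialCandidate := by
  obtain ⟨m₀, hm₀⟩ := hP
  refine ⟨max m₀ 1, fun m hm Γ hΓ hsub => ?_⟩
  have hm₀m : m₀ ≤ m := le_of_max_le_left hm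
  have hmpos : 0 < m := le_of_max_le_right hm
  -- Step 1 (NumericToPuiseux, proved support): a Laurent solution at the place over `x = 0`.
  obtain ⟨N, p, hN, hp⟩ := Summit.ValiantsHypothesis.Theorems.numericToPuiseux_proof m (m - 1)
    (fun i : Fin m => expo m (2 * (i : ℕ) + 1)) (fun i : Fin m => expo m (2 * (i : ℕ) + 2)) Γ hmpos hsub
  -- Step 2 (PeelingLemma): a short nonzero relation among the `2m` exponents.
  obtain ⟨u, v, huv, hlen, hrel⟩ := hm₀ m hm₀m _ _ Γ N p hΓ hN hp
  -- Step 3 (NoShortRelations, proved support): interleave `(u, v)` into `w : Fin (2m) → ℤ`.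
  let e : Fin m × Fin 2 ≃ Fin (2 * m) := finProdFinEquiv.trans (finCongr (Nat.mul_comm m 2))
  let F : Fin m × Fin 2 → ℤ := fun x => ![u x.1, v x.1] x.2
  let w : Fin (2 * m) → ℤ := fun j => F (e.symm j)
  have hwF : ∀ x, w (e x) = F x := fun x => by simp [w]
  have he : ∀ x : Fin m × Fin 2, ((e x : Fin (2 * m)) : ℕ) = (x.2 : ℕ) + 2 * (x.1 : ℕ) := by
    intro x
    simp [e]
  have he0 : ∀ i : Fin m, ((e (i, 0) : Fin (2 * m)) : ℕ) + 1 = 2 * (i : ℕ) + 1 := fun i => by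
    rw [he]; simp
  have he1 : ∀ i : Fin m, ((e (i, 1) : Fin (2 * m)) : ℕ) + 1 = 2 * (i : ℕ) + 2 := fun i => by
    rw [he]; simp only [Fin.isValue, Fin.val_one]; omega
  have habs : ∑ j, |w j| = ∑ i, (|u i| + |v i|) := by
    rw [← Fintype.sum_equiv e (fun x => |F x|) (fun j => |w j|) (fun x => by rw [hwF]),
      Fintype.sum_prod_type]
    refine Finset.sum_congr rfl fun i _ => ?_
    rw [Fin.sum_univ_two]
    simp [F]
  have hrelw : ∑ j, w j * ((expo m ((j : ℕ) + 1) : ℕ) : ℤ) =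
      ∑ i, (u i * ((expo m (2 * (i : ℕ) + 1) : ℕ) : ℤ) + v i * ((expo m (2 * (i : ℕ) + 2) : ℕ) : ℤ)) := by
    rw [← Fintype.sum_equiv e (fun x => F x * ((expo m (((e x : Fin (2 * m)) : ℕ) + 1) : ℕ) : ℤ))
      (fun j => w j * ((expo m ((j : ℕ) + 1) : ℕ) : ℤ)) (fun x => by rw [hwF]), Fintype.sum_prod_type]
    refine Finset.sum_congr rfl fun i _ => ?_
    rw [Fin.sum_univ_two, he0, he1]
    simp [F]
  have hw0 : w = 0 :=
    Summit.ValiantsHypothesis.ValiantsHypothesis.Theorems.BinomialElusiveNoShortRelations.noShortRelations_proof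
      m (Nat.log 2 m ^ 2) w (by rw [habs]; exact hlen) (by
        show ∑ j, w j * ((expo m ((j : ℕ) + 1) : ℕ) : ℤ) = 0
        rw [hrelw]
        simpa using hrel)
  -- Step 4: `w = 0` forces `(u, v) = 0`, contradicting PeelingLemma's nontriviality.
  have hu : u = 0 := funext fun i => by simpa [hwF, F] using congr_fun hw0 (e (i, 0))
  have hv : v = 0 := funext fun i => by simpa [hwF, F] using congr_fun hw0 (e (i, 1))
  exact huv (by rw [hu, hv]; rfl)

/-- **The crux from the two stubs** (composition; conclusion literally the route decl). -/
theorem BinomialCandidate_of :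
    Stmt.stub_integralPeeling → Stmt.stub_polarPeeling →
      Summit.ValiantsHypothesis.ValiantsHypothesis.Theses.BinomialElusive.BinomialCandidate :=
  fun h₁ h₂ => binomialCandidate_of_peelingLemma (peelingLemma_of_stubs h₁ h₂)

/-- THE SKELETON: the crux, modulo exactly the two registered stubs (compiler-checks that the `Stmt`
copies and the stub statements agree). -/
theorem BinomialCandidate_proof :
    Summit.ValiantsHypothesis.ValiantsHypothesis.Theses.BinomialElusive.BinomialCandidate :=
  BinomialCandidate_of stub_integralPeeling stub_polarPeeling

end Summit.ValiantsHypothesis.ValiantsHypothesis.Cruxes.BinomialCandidate.Birth
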